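import Mathlib.NumberTheory.Padics.Hensel
import Mathlib.NumberTheory.Padics.PadicNumbers
import Mathlib.Analysis.Normed.Group.Ultra
import Mathlib.AlgebraicGeometry.EllipticCurve.DivisionPolynomial.Basic
import HarnessLib

/-!
# The 3-adic Newton polygon of the 3-division polynomial: `E[3]|G_{ℚ₃}` has a stable line iff
# `4·v₃(c₆) < 3 + 6·v₃(c₄)` — the kernel certificate behind the census rule "locally reducible at 3 on every
# principal-series row" of route `CyclotomicUntwist` (crux K1 `PSRankOneLowerHalfAtThree`)

Cell `pub/bsd-wall` (D-0145 line `route-BirchSwinnertonDyer-CyclotomicUntwist`), seat `bsd-line-cycu-p1`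
(prover seat 1/3), helper toward crux K1 (stmt-BirchSwinnertonDyer-21580): it certifies the "why it might
fail" of the conjunct IMC₃ (memo `Cruxes/PSRankOneLowerHalfAtThree/K1-NEAREST-PRINT-v2.md`,
`L3-LOCAL-SHAPE-AT3-CENSUS-v2.md`): the one (pre)printed main-conjecture theorem with arbitrary reduction
at `p`, Fouquet–Wan 2021 Thm 1.7, excludes the residual local shape `ρ̄|G_{ℚ₃}^{ss} ≅ χ̄ ⊕ χ̄ω`, and a
`G_{ℚ₃}`-stable 𝔽₃-line in `E[3]` forces exactly that shape. THEOREMS ONLY (no definition, no named fact,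
no `sorry`); pure `3`-adic analysis of one quartic; BSD is not proved by this file and no crux is.

CONTENT. For `c₄, c₆ ∈ ℚ₃^×` let `ψ₃(x) = 3x⁴ − 162c₄x² − 648c₆x − 729c₄²` — Mathlib's `3`-division
polynomial `WeierstrassCurve.Ψ₃` of the c-model `y² = x³ − 27c₄x − 54c₆` (`eval_Ψ₃_cModel`), whose roots are
the `x`-coordinates of the four subgroups of order `3` (so "`ψ₃` has a `ℚ₃`-root" ⟺ "`E[3]` has a
`G_{ℚ₃}`-stable line" for any `E/ℚ₃` with these invariants — this dictionary is standard and stays in the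
docstrings). Write `a = v₃(c₄)`, `b = v₃(c₆)`; the coefficients of `x⁴, x², x, 1` have valuations
`1, 4+a, 4+b, 6+2a`.
* §3 `psiThree_ne_zero_of_lt`: if `4b > 3 + 6a` then `ψ₃(x) ≠ 0` for every `x ∈ ℚ₃` — for `v(x) = t` the four
  terms have valuations `1+4t, 4+a+2t, 4+b+t, 6+2a` with a UNIQUE minimum (`3x⁴` if `4t ≤ 4+2a`, `729c₄²` if
  `4t ≥ 6+2a`; `4t = 5+2a` is impossible), i.e. the Newton polygon is one edge of slope `−(5+2a)/4 ∉ ℤ`;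
* §4 `exists_psiThree_eq_zero_of_lt`: if `4b < 3 + 6a` then `ψ₃` HAS a root in `ℚ₃` — with `k = 2+2a−b`,
  `ψ₃(3^k t)/3^{6+2a} = q₄t⁴ + q₂t² + q₁t + q₀ ∈ ℤ₃[t]`, `‖q₄‖, ‖q₂‖ ≤ 3⁻¹`, `‖q₁‖ = ‖q₀‖ = 1`, so `t₀ = −q₀/q₁`
  satisfies `‖Q(t₀)‖ ≤ 3⁻¹ < 1 = ‖Q′(t₀)‖²` and Mathlib's `hensels_lemma` lifts it (the Newton polygon's first
  edge has length one);
* §5 `exists_psiThree_eq_zero_iff` (the criterion), `exists_isRoot_Ψ₃_cModel_iff` (Mathlib `Ψ₃` form),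
  `exists_isRoot_Ψ₃_cModel_iff_padicValRat` (for `W/ℚ` with `c₄ c₆ ≠ 0`: root ⟺
  `4·padicValRat 3 c₆ < 3 + 6·padicValRat 3 c₄`), `kraus_triples_regimes` (the wild Kraus triples:
  `(2,3,4), (3,5,6), (4,6,10), (5,8,12)` reducible — all principal-series / cyclic-inertia rows — versus
  `(2,4,3), (4,7,9)` irreducible; census L3-LOCAL-SHAPE-AT3-CENSUS: 9 777/9 777 classes agree).

References: [folklore] (Newton polygon / Hensel); context [cite: Kraus1990, Théorème (p = 3)] for the
triples, and Fouquet–Wan, arXiv:2107.13726, Thm 1.7 (hypothesis (Langlands)) for why the shape matters.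
-/

noncomputable section

open Polynomial

-- single-conjunct summit: `Summit.BirchSwinnertonDyer.BirchSwinnertonDyer.…` repeats the name by design
set_option linter.dupNamespace false

namespace Summit.BirchSwinnertonDyer.BirchSwinnertonDyer.Theorems.PSThreeDivision

/-! ### §1 `3`-adic norms of the constants -/

/-- `‖3‖₃ = 3⁻¹`. [folklore] -/
theorem norm_three : ‖(3 : ℚ_[3])‖ = (3 : ℝ)⁻¹ := by
  have := Padic.norm_p (p := 3)
  simpa using this

/-- `‖3^n‖₃ = 3^{-n}`. [folklore] -/
theorem norm_three_zpow (n : ℤ) : ‖(3 : ℚ_[3]) ^ n‖ = (3 : ℝ) ^ (-n) := by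
  rw [norm_zpow, norm_three, inv_zpow']

/-- `‖162‖₃ = 3^{-4}` (`162 = 2·3⁴`; an integer prime to `3` has norm `1`, tree lemma
`…RegMult.KernelCert.norm_intCast_eq_one_of_not_dvd`, inlined to keep imports light). [folklore] -/
theorem norm_162 : ‖(162 : ℚ_[3])‖ = (3 : ℝ) ^ (-4 : ℤ) := by
  have h2 : ‖((2 : ℤ) : ℚ_[3])‖ = 1 :=
    le_antisymm (Padic.norm_int_le_one 2) (not_lt.mp fun h ↦
      absurd ((Padic.norm_intCast_lt_one_iff (p := 3)).mp h) (by decide))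
  rw [show (162 : ℚ_[3]) = ((2 : ℤ) : ℚ_[3]) * (3 : ℚ_[3]) ^ (4 : ℤ) by norm_num, norm_mul, h2, one_mul,
    norm_three_zpow]

/-- `‖648‖₃ = 3^{-4}` (`648 = 8·3⁴`). [folklore] -/
theorem norm_648 : ‖(648 : ℚ_[3])‖ = (3 : ℝ) ^ (-4 : ℤ) := by
  have h8 : ‖((8 : ℤ) : ℚ_[3])‖ = 1 :=
    le_antisymm (Padic.norm_int_le_one 8) (not_lt.mp fun h ↦
      absurd ((Padic.norm_intCast_lt_one_iff (p := 3)).mp h) (by decide))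
  rw [show (648 : ℚ_[3]) = ((8 : ℤ) : ℚ_[3]) * (3 : ℚ_[3]) ^ (4 : ℤ) by norm_num, norm_mul, h8, one_mul,
    norm_three_zpow]

/-- `‖729‖₃ = 3^{-6}` (`729 = 3⁶`). [folklore] -/
theorem norm_729 : ‖(729 : ℚ_[3])‖ = (3 : ℝ) ^ (-6 : ℤ) := by
  rw [show (729 : ℚ_[3]) = (3 : ℚ_[3]) ^ (6 : ℤ) by norm_num, norm_three_zpow]

/-- `‖x‖₃ = 3^{-v(x)}` for `x ≠ 0`. [folklore] -/
theorem norm_eq_three_zpow {x : ℚ_[3]} (hx : x ≠ 0) : ‖x‖ = (3 : ℝ) ^ (-x.valuation) := by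
  have := Padic.norm_eq_zpow_neg_valuation hx
  simpa using this

/-! ### §2 The four terms of `ψ₃(x) = 3x⁴ − 162c₄x² − 648c₆x − 729c₄²` and their norms -/

section Terms

variable {c₄ c₆ x : ℚ_[3]}

/-- `‖3x⁴‖ = 3^{-(1+4t)}`, `t = v(x)`. [folklore] -/
theorem norm_term4 (hx : x ≠ 0) : ‖3 * x ^ 4‖ = (3 : ℝ) ^ (-(1 + 4 * x.valuation)) := by
  rw [norm_mul, norm_pow, norm_three, norm_eq_three_zpow hx, ← zpow_natCast, ← zpow_mul,
    ← zpow_neg_one, ← zpow_add₀ (by norm_num : (3 : ℝ) ≠ 0)]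
  congr 1; ring

/-- `‖162c₄x²‖ = 3^{-(4+a+2t)}`. [folklore] -/
theorem norm_term2 (h₄ : c₄ ≠ 0) (hx : x ≠ 0) :
    ‖162 * c₄ * x ^ 2‖ = (3 : ℝ) ^ (-(4 + c₄.valuation + 2 * x.valuation)) := by
  rw [norm_mul, norm_mul, norm_pow, norm_162, norm_eq_three_zpow h₄, norm_eq_three_zpow hx,
    ← zpow_natCast, ← zpow_mul, ← zpow_add₀ (by norm_num : (3 : ℝ) ≠ 0),
    ← zpow_add₀ (by norm_num : (3 : ℝ) ≠ 0)]
  congr 1; push_cast; ring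

/-- `‖648c₆x‖ = 3^{-(4+b+t)}`. [folklore] -/
theorem norm_term1 (h₆ : c₆ ≠ 0) (hx : x ≠ 0) :
    ‖648 * c₆ * x‖ = (3 : ℝ) ^ (-(4 + c₆.valuation + x.valuation)) := by
  rw [norm_mul, norm_mul, norm_648, norm_eq_three_zpow h₆, norm_eq_three_zpow hx,
    ← zpow_add₀ (by norm_num : (3 : ℝ) ≠ 0), ← zpow_add₀ (by norm_num : (3 : ℝ) ≠ 0)]
  congr 1; ring

/-- `‖729c₄²‖ = 3^{-(6+2a)}`. [folklore] -/
theorem norm_term0 (h₄ : c₄ ≠ 0) : ‖729 * c₄ ^ 2‖ = (3 : ℝ) ^ (-(6 + 2 * c₄.valuation)) := by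
  rw [norm_mul, norm_pow, norm_729, norm_eq_three_zpow h₄, ← zpow_natCast, ← zpow_mul,
    ← zpow_add₀ (by norm_num : (3 : ℝ) ≠ 0)]
  congr 1; push_cast; ring

end Terms

/-- Exponent comparison: `3^{-e} < 3^{-e'}` iff `e' < e`. [folklore] -/
theorem three_zpow_neg_lt_iff {e e' : ℤ} : (3 : ℝ) ^ (-e) < (3 : ℝ) ^ (-e') ↔ e' < e := by
  rw [zpow_lt_zpow_iff_right₀ (by norm_num : (1 : ℝ) < 3)]; omega

/-- Ultrametric bound for three terms. [folklore] -/
theorem norm_add_add_le_of_lt {u v w : ℚ_[3]} {C : ℝ} (hu : ‖u‖ < C) (hv : ‖v‖ < C) (hw : ‖w‖ < C) :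
    ‖u + v + w‖ < C := by
  refine lt_of_le_of_lt (IsUltrametricDist.norm_add_le_max _ _) (max_lt ?_ hw)
  exact lt_of_le_of_lt (IsUltrametricDist.norm_add_le_max _ _) (max_lt hu hv)

/-- If one summand strictly dominates, the sum has its norm (hence is non-zero). [folklore] -/
theorem norm_add_eq_of_lt {d r : ℚ_[3]} (h : ‖r‖ < ‖d‖) : ‖d + r‖ = ‖d‖ := by
  rw [IsUltrametricDist.norm_add_eq_max_of_norm_ne_norm (ne_of_gt h), max_eq_left h.le]

/-! ### §3 IRREDUCIBLE regime `4·v(c₆) > 3 + 6·v(c₄)`: `ψ₃` has no root in `ℚ₃` -/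

/-- **No `ℚ₃`-root when `4v₃(c₆) > 3 + 6v₃(c₄)`**: the Newton polygon of
`ψ₃ = 3x⁴ − 162c₄x² − 648c₆x − 729c₄²` is then a single edge of slope `−(5+2v₃c₄)/4 ∉ ℤ`; concretely, for
`x ∈ ℚ₃` with `v(x) = t` the four terms have valuations `1+4t, 4+a+2t, 4+b+t, 6+2a` whose minimum is attained
exactly once (by `3x⁴` if `4t ≤ 4+2a`, by `729c₄²` if `4t ≥ 6+2a`), so `ψ₃(x) ≠ 0`. For an elliptic curve
with invariants `c₄, c₆` this `ψ₃` is the `3`-division polynomial of the `ℚ`-isomorphic model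
`y² = x³ − 27c₄x − 54c₆`, whose roots are the `x`-coordinates of the four subgroups of order `3`; so in this
regime `E[3]` has NO `G_{ℚ₃}`-stable line (Kraus triples `(2,4,3)`, `(4,7,9)` of the wild dicyclic rows).
[folklore] -/
theorem psiThree_ne_zero_of_lt {c₄ c₆ : ℚ_[3]} (h₄ : c₄ ≠ 0) (h₆ : c₆ ≠ 0)
    (h : 3 + 6 * c₄.valuation < 4 * c₆.valuation) (x : ℚ_[3]) :
    3 * x ^ 4 - 162 * c₄ * x ^ 2 - 648 * c₆ * x - 729 * c₄ ^ 2 ≠ 0 := by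
  set a := c₄.valuation with ha
  set b := c₆.valuation with hb
  by_cases hx : x = 0
  · subst hx
    simp [h₄]
  set t := x.valuation with ht
  have n4 := norm_term4 hx
  have n2 := norm_term2 h₄ hx
  have n1 := norm_term1 h₆ hx
  have n0 := norm_term0 h₄
  rw [← ha] at n2 n0; rw [← hb] at n1; rw [← ht] at n4 n2 n1
  rcases (show 4 * t ≤ 4 + 2 * a ∨ 6 + 2 * a ≤ 4 * t by omega) with hle | hge
  · -- dominant term `3x⁴`
    have e : 3 * x ^ 4 - 162 * c₄ * x ^ 2 - 648 * c₆ * x - 729 * c₄ ^ 2 =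
        3 * x ^ 4 + (-(162 * c₄ * x ^ 2) + -(648 * c₆ * x) + -(729 * c₄ ^ 2)) := by ring
    rw [e, ← norm_pos_iff, norm_add_eq_of_lt, n4]
    · exact zpow_pos (by norm_num) _
    · rw [n4]
      refine norm_add_add_le_of_lt ?_ ?_ ?_
      · rw [norm_neg, n2, three_zpow_neg_lt_iff]; omega
      · rw [norm_neg, n1, three_zpow_neg_lt_iff]; omega
      · rw [norm_neg, n0, three_zpow_neg_lt_iff]; omega
  · -- dominant term `729c₄²`
    have e : 3 * x ^ 4 - 162 * c₄ * x ^ 2 - 648 * c₆ * x - 729 * c₄ ^ 2 =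
        -(729 * c₄ ^ 2) + (3 * x ^ 4 + -(162 * c₄ * x ^ 2) + -(648 * c₆ * x)) := by ring
    rw [e, ← norm_pos_iff, norm_add_eq_of_lt, norm_neg, n0]
    · exact zpow_pos (by norm_num) _
    · rw [norm_neg, n0]
      refine norm_add_add_le_of_lt ?_ ?_ ?_
      · rw [n4, three_zpow_neg_lt_iff]; omega
      · rw [norm_neg, n2, three_zpow_neg_lt_iff]; omega
      · rw [norm_neg, n1, three_zpow_neg_lt_iff]; omega


/-! ### §4 REDUCIBLE regime `4·v(c₆) < 3 + 6·v(c₄)`: `ψ₃` has a root in `ℚ₃` (Hensel) -/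

/-- Products of powers of `3` in `ℝ`. [folklore] -/
theorem three_zpow_mul (e f : ℤ) : (3 : ℝ) ^ e * (3 : ℝ) ^ f = (3 : ℝ) ^ (e + f) :=
  (zpow_add₀ (by norm_num) e f).symm

/-- **A `ℚ₃`-root when `4v₃(c₆) < 3 + 6v₃(c₄)`**: with `k = 2 + 2a − b` (`a = v₃c₄`, `b = v₃c₆`) the
substitution `x = 3^k t` and division by `3^{6+2a}` turn `ψ₃` into `Q(t) = q₄t⁴ + q₂t² + q₁t + q₀ ∈ ℤ₃[t]`
with `‖q₄‖, ‖q₂‖ ≤ 3⁻¹` and `‖q₁‖ = ‖q₀‖ = 1`, so `t₀ = −q₀/q₁` is a simple root mod `3` and Hensel's lemma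
(Mathlib `hensels_lemma`) lifts it — the Newton polygon's first edge has length one. For an elliptic curve with
invariants `c₄, c₆` this gives a `ℚ₃`-rational root of the `3`-division polynomial of the model
`y² = x³ − 27c₄x − 54c₆`, i.e. a `G_{ℚ₃}`-stable line in `E[3]` (every principal-series / cyclic-inertia wild
row: Kraus triples `(2,3,4)`, `(3,5,6)`, `(4,6,10)`, `(5,8,12)`, …). [folklore] -/
theorem exists_psiThree_eq_zero_of_lt {c₄ c₆ : ℚ_[3]} (h₄ : c₄ ≠ 0) (h₆ : c₆ ≠ 0)
    (h : 4 * c₆.valuation < 3 + 6 * c₄.valuation) :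
    ∃ x : ℚ_[3], 3 * x ^ 4 - 162 * c₄ * x ^ 2 - 648 * c₆ * x - 729 * c₄ ^ 2 = 0 := by
  set a := c₄.valuation with ha
  set b := c₆.valuation with hb
  have h3 : (3 : ℚ_[3]) ≠ 0 := by norm_num
  set k : ℤ := 2 + 2 * a - b with hk
  set s : ℚ_[3] := (3 : ℚ_[3]) ^ k with hs
  set M : ℚ_[3] := (3 : ℚ_[3]) ^ (6 + 2 * a) with hM
  have hM0 : M ≠ 0 := zpow_ne_zero _ h3
  -- rescaled coefficients (all written with integral powers of `3`)
  set q₄ : ℚ_[3] := (3 : ℚ_[3]) ^ (4 * k - 5 - 2 * a) with hq₄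
  set q₂ : ℚ_[3] := -(162 * c₄ * (3 : ℚ_[3]) ^ (2 * k - 6 - 2 * a)) with hq₂
  set q₁ : ℚ_[3] := -(648 * c₆ * (3 : ℚ_[3]) ^ (k - 6 - 2 * a)) with hq₁
  set q₀ : ℚ_[3] := -(729 * c₄ ^ 2 * (3 : ℚ_[3]) ^ (-(6 + 2 * a))) with hq₀
  -- the un-scaling identities `M · qᵢ = coefficient of ψ₃(s·t)`
  have e₄ : M * q₄ = 3 * s ^ 4 := by
    rw [hM, hq₄, hs, ← zpow_add₀ h3, ← zpow_natCast, ← zpow_mul, ← zpow_one_add₀ h3]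
    congr 1; push_cast; ring
  have e₂ : M * q₂ = -(162 * c₄ * s ^ 2) := by
    rw [hM, hq₂, hs, mul_neg, ← zpow_natCast, ← zpow_mul]
    congr 1
    rw [mul_comm, mul_assoc, ← zpow_add₀ h3]
    congr 2; push_cast; ring
  have e₁ : M * q₁ = -(648 * c₆ * s) := by
    rw [hM, hq₁, hs, mul_neg]
    congr 1
    rw [mul_comm, mul_assoc, ← zpow_add₀ h3]
    congr 2; ring
  have e₀ : M * q₀ = -(729 * c₄ ^ 2) := by
    rw [hM, hq₀, mul_neg]
    congr 1
    rw [mul_comm, mul_assoc, ← zpow_add₀ h3, neg_add_cancel, zpow_zero, mul_one]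
  -- norms of the rescaled coefficients
  have n4 : ‖q₄‖ ≤ (3 : ℝ) ^ (-1 : ℤ) := by
    rw [hq₄, norm_three_zpow]
    exact zpow_le_zpow_right₀ (by norm_num) (by omega)
  have n2 : ‖q₂‖ ≤ (3 : ℝ) ^ (-1 : ℤ) := by
    rw [hq₂, norm_neg, norm_mul, norm_mul, norm_162, norm_eq_three_zpow h₄, norm_three_zpow,
      three_zpow_mul, three_zpow_mul]
    exact zpow_le_zpow_right₀ (by norm_num) (by omega)
  have n1 : ‖q₁‖ = 1 := by
    rw [hq₁, norm_neg, norm_mul, norm_mul, norm_648, norm_eq_three_zpow h₆, norm_three_zpow,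
      three_zpow_mul, three_zpow_mul, ← hb]
    rw [show (-4 : ℤ) + -b + -(k - 6 - 2 * a) = 0 by omega, zpow_zero]
  have n0 : ‖q₀‖ = 1 := by
    rw [hq₀, norm_neg, norm_mul, norm_mul, norm_pow, norm_729, norm_eq_three_zpow h₄, norm_three_zpow,
      ← zpow_natCast, ← zpow_mul, three_zpow_mul, three_zpow_mul, ← ha]
    rw [show (-6 : ℤ) + -a * ((2 : ℕ) : ℤ) + -(-(6 + 2 * a)) = 0 by push_cast; ring, zpow_zero]
  -- lift to `ℤ₃`
  have h31 : (3 : ℝ) ^ (-1 : ℤ) < 1 := by norm_num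
  let Q₄ : ℤ_[3] := ⟨q₄, n4.trans h31.le⟩
  let Q₂ : ℤ_[3] := ⟨q₂, n2.trans h31.le⟩
  let Q₁ : ℤ_[3] := ⟨q₁, n1.le⟩
  let Q₀ : ℤ_[3] := ⟨q₀, n0.le⟩
  have hQ₄ : ‖Q₄‖ ≤ (3 : ℝ) ^ (-1 : ℤ) := n4
  have hQ₂ : ‖Q₂‖ ≤ (3 : ℝ) ^ (-1 : ℤ) := n2
  have hQ₁ : ‖Q₁‖ = 1 := n1
  have hQ₀ : ‖Q₀‖ = 1 := n0
  have hu : IsUnit Q₁ := PadicInt.isUnit_iff.mpr hQ₁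
  set t₀ : ℤ_[3] := -Q₀ * ↑(hu.unit⁻¹) with ht₀
  have hlin : Q₁ * t₀ + Q₀ = 0 := by
    rw [ht₀]
    calc Q₁ * (-Q₀ * ↑hu.unit⁻¹) + Q₀ = -Q₀ * (Q₁ * ↑hu.unit⁻¹) + Q₀ := by ring
      _ = 0 := by rw [hu.mul_val_inv]; ring
  set F : Polynomial ℤ_[3] := C Q₄ * X ^ 4 + C Q₂ * X ^ 2 + C Q₁ * X + C Q₀ with hF
  have hFev : ∀ t : ℤ_[3], F.aeval t = Q₄ * t ^ 4 + Q₂ * t ^ 2 + Q₁ * t + Q₀ := by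
    intro t
    rw [Polynomial.coe_aeval_eq_eval, hF]
    simp only [eval_add, eval_mul, eval_C, eval_pow, eval_X]
  have hFd' : F.derivative = C (Q₄ * 4) * X ^ 3 + C (Q₂ * 2) * X + C Q₁ := by
    rw [hF]
    simp only [derivative_add, derivative_C_mul_X_pow, derivative_C_mul_X, derivative_C, add_zero]
    norm_num
  have hFder : ∀ t : ℤ_[3], F.derivative.aeval t = Q₄ * 4 * t ^ 3 + Q₂ * 2 * t + Q₁ := by
    intro t
    rw [Polynomial.coe_aeval_eq_eval, hFd']
    simp only [eval_add, eval_mul, eval_C, eval_pow, eval_X]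
  -- `‖F(t₀)‖ ≤ 3⁻¹`, `‖F′(t₀)‖ = 1`
  have ht₀le : ‖t₀‖ ≤ 1 := PadicInt.norm_le_one t₀
  have hsmall : ∀ (c : ℤ_[3]) (n : ℕ) (m : ℤ_[3]), ‖c‖ ≤ (3 : ℝ) ^ (-1 : ℤ) → ‖m‖ ≤ 1 →
      ‖c * m * t₀ ^ n‖ ≤ (3 : ℝ) ^ (-1 : ℤ) := by
    intro c n m hc hm
    rw [norm_mul, norm_mul, norm_pow]
    calc ‖c‖ * ‖m‖ * ‖t₀‖ ^ n ≤ (3 : ℝ) ^ (-1 : ℤ) * 1 * 1 ^ n := by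
          gcongr
      _ = (3 : ℝ) ^ (-1 : ℤ) := by ring
  have hFt₀ : ‖F.aeval t₀‖ ≤ (3 : ℝ) ^ (-1 : ℤ) := by
    rw [hFev, add_assoc, hlin, add_zero]
    refine (IsUltrametricDist.norm_add_le_max _ _).trans (max_le ?_ ?_)
    · simpa using hsmall Q₄ 4 1 hQ₄ (by simp)
    · simpa using hsmall Q₂ 2 1 hQ₂ (by simp)
  have hFd : ‖F.derivative.aeval t₀‖ = 1 := by
    rw [hFder, add_comm]
    have hr : ‖Q₄ * 4 * t₀ ^ 3 + Q₂ * 2 * t₀‖ < ‖Q₁‖ := by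
      rw [hQ₁]
      refine lt_of_le_of_lt (IsUltrametricDist.norm_add_le_max _ _) (max_lt ?_ ?_)
      · exact (hsmall Q₄ 3 4 hQ₄ (PadicInt.norm_le_one _)).trans_lt h31
      · have := hsmall Q₂ 1 2 hQ₂ (PadicInt.norm_le_one _)
        rw [pow_one] at this
        exact this.trans_lt h31
    rw [IsUltrametricDist.norm_add_eq_max_of_norm_ne_norm (ne_of_gt hr), max_eq_left hr.le, hQ₁]
  have hnorm : ‖F.aeval t₀‖ < ‖F.derivative.aeval t₀‖ ^ 2 := by
    rw [hFd, one_pow]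
    exact hFt₀.trans_lt h31
  obtain ⟨z, hz, -⟩ := hensels_lemma hnorm
  -- back to `ℚ₃`
  refine ⟨s * (z : ℚ_[3]), ?_⟩
  have hz' : q₄ * (z : ℚ_[3]) ^ 4 + q₂ * (z : ℚ_[3]) ^ 2 + q₁ * (z : ℚ_[3]) + q₀ = 0 := by
    have := congrArg ((↑) : ℤ_[3] → ℚ_[3]) ((hFev z).symm.trans hz)
    push_cast at this
    exact this
  linear_combination (-(z : ℚ_[3]) ^ 4) * e₄ - (z : ℚ_[3]) ^ 2 * e₂ - (z : ℚ_[3]) * e₁ - e₀ + M * hz'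


/-! ### §5 Packaging: the root criterion, Mathlib's `Ψ₃` of the c-model, rational invariants -/

/-- **The `3`-adic root criterion**: for `c₄, c₆ ≠ 0`,
`ψ₃ = 3x⁴ − 162c₄x² − 648c₆x − 729c₄²` has a root in `ℚ₃` **iff** `4·v₃(c₆) < 3 + 6·v₃(c₄)` (equality is
impossible by parity, so the two regimes of §3 and §4 are complementary). [folklore] -/
theorem exists_psiThree_eq_zero_iff {c₄ c₆ : ℚ_[3]} (h₄ : c₄ ≠ 0) (h₆ : c₆ ≠ 0) :
    (∃ x : ℚ_[3], 3 * x ^ 4 - 162 * c₄ * x ^ 2 - 648 * c₆ * x - 729 * c₄ ^ 2 = 0) ↔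
      4 * c₆.valuation < 3 + 6 * c₄.valuation := by
  refine ⟨fun ⟨x, hx⟩ ↦ ?_, exists_psiThree_eq_zero_of_lt h₄ h₆⟩
  by_contra hle
  have hlt : 3 + 6 * c₄.valuation < 4 * c₆.valuation := by omega
  exact psiThree_ne_zero_of_lt h₄ h₆ hlt x hx

/-- **The polynomial IS Mathlib's `3`-division polynomial `Ψ₃` of the c-model** `y² = x³ − 27c₄x − 54c₆`
(`a₁ = a₂ = a₃ = 0`, `a₄ = −27c₄`, `a₆ = −54c₆`: `b₂ = 0`, `b₄ = −54c₄`, `b₆ = −216c₆`, `b₈ = −729c₄²`), over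
any commutative ring. For an elliptic curve `E` with invariants `c₄, c₆` over a field of characteristic
`≠ 2, 3` this model is isomorphic to `E` (`(x,y) ↦ (36x + 3b₂, 108(2y + a₁x + a₃))`), and the roots of `Ψ₃`
are the `x`-coordinates of the four subgroups of order `3`. [folklore] -/
theorem eval_Ψ₃_cModel {R : Type*} [CommRing R] (c₄ c₆ x : R) :
    (⟨0, 0, 0, -27 * c₄, -54 * c₆⟩ : WeierstrassCurve R).Ψ₃.eval x =
      3 * x ^ 4 - 162 * c₄ * x ^ 2 - 648 * c₆ * x - 729 * c₄ ^ 2 := by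
  simp only [WeierstrassCurve.Ψ₃, WeierstrassCurve.b₂, WeierstrassCurve.b₄, WeierstrassCurve.b₆,
    WeierstrassCurve.b₈, eval_add, eval_mul, eval_pow, eval_C, eval_X, eval_ofNat]
  ring

/-- **Root criterion for `Ψ₃` of the c-model over `ℚ₃`** (Mathlib's division polynomial): a `ℚ₃`-root
exists iff `4·v₃(c₆) < 3 + 6·v₃(c₄)`. [folklore] -/
theorem exists_isRoot_Ψ₃_cModel_iff {c₄ c₆ : ℚ_[3]} (h₄ : c₄ ≠ 0) (h₆ : c₆ ≠ 0) :
    (∃ x : ℚ_[3], (⟨0, 0, 0, -27 * c₄, -54 * c₆⟩ : WeierstrassCurve ℚ_[3]).Ψ₃.IsRoot x) ↔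
      4 * c₆.valuation < 3 + 6 * c₄.valuation := by
  simp only [IsRoot.def, eval_Ψ₃_cModel]
  exact exists_psiThree_eq_zero_iff h₄ h₆

/-- **Rational invariants** (the census form): for an elliptic curve over `ℚ` with `c₄, c₆ ≠ 0` —
in particular for every globally minimal `W/ℚ` off `j ∈ {0, 1728}` — the `3`-division polynomial of its
c-model has a root in `ℚ₃` iff `4·v₃(c₆) < 3 + 6·v₃(c₄)` (`padicValRat`). On the wild rows at `3` this is
the census rule "E[3]|G_{ℚ₃} has a stable line ⟺ Kraus triple ∉ {(2,4,3), (4,7,9)}": the principal-series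
and cyclic-inertia triples `(2,3,4)`, `(3,5,6)`, `(4,6,10)`, `(5,8,12)` satisfy `4b < 3+6a`
(`12<15, 20<21, 24<27, 32<33`), the dicyclic `(2,4,3)`, `(4,7,9)` violate it (`16>15, 28>27`).
[folklore] -/
theorem exists_isRoot_Ψ₃_cModel_iff_padicValRat (W : WeierstrassCurve ℚ) (h₄ : W.c₄ ≠ 0) (h₆ : W.c₆ ≠ 0) :
    (∃ x : ℚ_[3], (⟨0, 0, 0, -27 * (W.c₄ : ℚ_[3]), -54 * (W.c₆ : ℚ_[3])⟩ : WeierstrassCurve ℚ_[3]).Ψ₃.IsRoot x) ↔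
      4 * padicValRat 3 W.c₆ < 3 + 6 * padicValRat 3 W.c₄ := by
  rw [exists_isRoot_Ψ₃_cModel_iff (by exact_mod_cast h₄) (by exact_mod_cast h₆),
    Padic.valuation_ratCast, Padic.valuation_ratCast]

/-- The two Kraus triples of the irreducible regime and the four of the reducible one, as arithmetic
(sanity of the census dictionary). [folklore] -/
theorem kraus_triples_regimes :
    (4 * (4 : ℤ) > 3 + 6 * 2 ∧ 4 * (7 : ℤ) > 3 + 6 * 4) ∧
      (4 * (3 : ℤ) < 3 + 6 * 2 ∧ 4 * (5 : ℤ) < 3 + 6 * 3 ∧ 4 * (6 : ℤ) < 3 + 6 * 4 ∧ 4 * (8 : ℤ) < 3 + 6 * 5) := by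
  norm_num

end Summit.BirchSwinnertonDyer.BirchSwinnertonDyer.Theorems.PSThreeDivision

end
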